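import Literature.AlgebraicGeometry.HodgeTheory.WeilClassesCyclicPrymDegreeThree
import Literature.AlgebraicGeometry.HodgeTheory.SurjectivePullbackAlgebraicClasses
import HarnessLib

/-!
# Schoen's cyclic Prym facts: the transfer of Cor. 3.1 by the degree trick

Topic `AlgebraicGeometry/HodgeTheory`; namespace `Literature.AlgebraicGeometry.HodgeTheory`. Seventh
theorem-only companion (no definition, no named fact, sorry-free) of the named facts
`Schoen1988_cyclicPrym_weilClasses_algebraic_degreeSix` / `…degreeThree` (`WeilClassesCyclicPrym.lean`;
C. Schoen, Compositio Math. 65 (1988), Cor. 3.1 with Thm. 2.0 — Patel–Zhang 2025, Thm 5.3 / Thm 1.2).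

Schoen, proof of Cor. 3.1 (pp. 24–25), verbatim: "Let `j : B → Alb(C)` denote the inclusion. Then
`P ∘ j ∈ End(B)` is multiplication by a non-zero scalar. Thus it suffices to show that `U'' = P^* U'`
is generated by algebraic cycles. Recall the notation `Ξ : Cʰ → Alb(C)` from (1.4) […] the projection
formula and Poincaré's formula [G-H, p. 350] yield […] By the hard Lefschetz theorem […] According to
a theorem of Lieberman [K; 2A11.2, 2.3] the inverse to the hard Lefschetz isomorphism on an abelian
variety is 'algebraic' […] The Corrollary follows since `U` is generated by algebraic cycles (2.0)."
Here `U = Ξ^* U'' = (P ∘ Ξ)^* U' ⊂ Hʰ(Cʰ, ℚ)` ((1.4), Lemma 1.1) and `P ∘ Ξ : Cʰ → B` is a SURJECTIVE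
morphism between smooth projective varieties of the SAME dimension `h = dim B` (`h` points of the
generating curve `P(f(C))` fill the `h`-fold `B`).

This file replaces the displayed chain (projection formula + Poincaré's formula + hard Lefschetz +
Lieberman) by the degree trick of `HodgeTheory/SurjectivePullbackAlgebraicClasses`
(`φ_* φ^* = c • id`, `c ≠ 0`, and `φ_*` preserves algebraic classes, for `φ` surjective and
equidimensional — all PROVED there on the tree's real carriers), and records the resulting form of
the remaining geometric input of the two named facts:

* `Motives.AbelianVariety.le_algebraicClasses_of_surjective_of_forall_map_mem`,
  `Motives.AbelianVariety.mem_algebraicClasses_iff_map_mem_of_surjective` — for an abelian variety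
  `B`, a smooth projective `Y` of dimension `dim B` and a surjective `φ : Y ⟶ B`: a class (a subspace)
  of `H²ᵖ(B(ℂ))` is algebraic iff its pull-back to `Y` is (`⇐` the degree trick; `⇒` the tree's
  `map_mem_algebraicClasses_of_abelianVariety`, Fulton Cor. 19.2 (b)).
* `eigenspace_sup_eigenspace_le_algebraicClasses_of_surjective_of_forall_map_mem` (needs NEITHER
  `dim B = 8` NOR `ψ₀² = -3`) and `…_of_surjective_of_exists` (`dim B = 8`, `ψ₀² = -3`, ONE non-zero
  class of the Weil plane with algebraic pull-back) — the Weil plane `E₊ ⊔ E₋` of `(B, ψ₀)` is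
  algebraic as soon as its pull-back along some surjective equidimensional `φ : Y ⟶ B` is;
  `weilClassesOf_le_algebraicClasses_of_surjective_of_exists` — the same in the `weilClassesOf` form
  of the degree-`3` fact.
* ASSEMBLIES. `Schoen1988_cyclicPrym_weilClasses_algebraic_degreeSix_of_forall_exists_surjective` —
  the degree-`6` fact follows from: for every Schoen datum `(C, 𝒥, α, s, B, s_B, ψ₀)` there are a
  smooth projective `Y` of dimension `dim B` and a surjective `φ : Y ⟶ B` with `φ^*(E₊ ⊔ E₋)`
  algebraic on `Y` — Schoen's Thm. 2.0 (case `r = 0`) for `Y = C⁸`, `φ = P ∘ Ξ`, in transferred form;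
  this assembly does NOT use the Jacobian-dimension fact `Motives.two_mul_dim_eq_finrank_bettiCohomology`.
  `…_of_finrank_le_of_exists_surjective` — from (i′) `b₁(C(ℂ)) ≤ 2 dim J` on Schoen data (gives
  `dim B = 8`) and ONE non-zero Weil class with algebraic pull-back along a surjective `Y⁸ ⟶ B`;
  `…_of_two_mul_dim_eq_of_exists_surjective`, `…_of_isIso_of_exists_surjective` — the same from the
  named Jacobian facts; and the degree-`3` twins `Schoen1988_cyclicPrym_weilClasses_algebraic_degreeThree_of_…`.

What remains of Schoen's theorem after this file is exactly his Thm. 2.0 (the cycles `z_χ` on `C⁸`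
built from the `|G|` copies `Q_t ≅ ℙ^{q-1}` of the canonical system inside the pulled-back symmetric
power, and `U ⊆` their span) together with the surjectivity of `P ∘ Ξ : C⁸ → B`; none of it is
restated here as a named fact (D-0026).

## References

* [Schoen1988HodgeWeil] C. Schoen, Hodge classes on self-products of a variety with an automorphism,
  Compositio Math. 65 (1988), 3–32: §1 Lemma 1.1, (1.4), Thm. 2.0 (p. 11), §3 Cor. 3.1 (p. 24) and
  its proof (pp. 24–25), Thm. 3.2 (proof, p. 25).
* [PatelZhang2025PrymHodge] D. Patel, Z. Zhang, arXiv:2506.13729 (2025): Lemma 4.3, Thm 4.4,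
  Lemma 4.5, Lemma 5.1, Thm 5.3, Thm 1.2.
* [VoisinHodgeI2002] C. Voisin, Hodge Theory and Complex Algebraic Geometry I, §7.3.2 Remark 7.29.
* [Fulton1998] W. Fulton, Intersection Theory, §19.2 Cor. 19.2 (b).
* [Milne1986JacobianVarieties] J. S. Milne, Jacobian Varieties, §2 Prop. 2.1, Thm. 2.5.
-/

noncomputable section

namespace Literature.AlgebraicGeometry.HodgeTheory

open CategoryTheory AlgebraicGeometry
open Literature.AlgebraicGeometry Literature.AlgebraicGeometry.Motives

/-! ### §1 Algebraic classes on an abelian variety are detected on any surjective equidimensional cover -/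

section AbelianVariety

variable (B : Motives.AbelianVariety ℂ) {Y : Motives.SchemeOver ℂ}

/-- **A subspace of `H²ᵖ(B(ℂ))` whose pull-back along a surjective `φ : Y ⟶ B`, `dim Y = dim B`,
consists of algebraic classes, consists of algebraic classes** (the degree trick
`le_algebraicClasses_of_map_le_of_surjective` for the smooth projective `B` of dimension `dim B`).
This is the transfer "`U = Ξ^* P^* U'` generated by algebraic cycles ⇒ `U'` generated by algebraic
cycles" of Schoen's Cor. 3.1 without Poincaré's formula, hard Lefschetz or Lieberman's theorem.
[cite: Schoen1988HodgeWeil, §3 Cor. 3.1 (proof, pp. 24–25)] [cite: VoisinHodgeI2002, §7.3.2 Remark 7.29] -/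
theorem Motives.AbelianVariety.le_algebraicClasses_of_surjective_of_forall_map_mem
    (hY : IsSmoothProjective B.dim Y) (φ : Y ⟶ B.X) [AlgebraicGeometry.Surjective φ.left] {p : ℕ}
    {S : Submodule ℂ (complexBetti B.X (2 * p))}
    (h : ∀ c ∈ S, complexBetti.map φ (2 * p) c ∈ algebraicClasses Y p) :
    S ≤ algebraicClasses B.X p := fun _ hc ↦
  mem_algebraicClasses_of_map_mem_of_surjective hY
    (Motives.AbelianVariety.isSmoothProjective_holds : IsSmoothProjective B.dim B.X) φ (h _ hc)

/-- **A class on an abelian variety `B` is algebraic iff its pull-back along a surjective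
`φ : Y ⟶ B`, `dim Y = dim B`, is**: `⇐` is the degree trick, `⇒` the contravariance of algebraic
classes for maps into abelian varieties (`map_mem_algebraicClasses_of_abelianVariety`, Fulton
Cor. 19.2 (b) through Kleiman's moving lemma).
[cite: VoisinHodgeI2002, §7.3.2 Remark 7.29] [cite: Fulton1998, §19.2 Cor. 19.2 (b)] -/
theorem Motives.AbelianVariety.mem_algebraicClasses_iff_map_mem_of_surjective
    (hY : IsSmoothProjective B.dim Y) (φ : Y ⟶ B.X) [AlgebraicGeometry.Surjective φ.left] {p : ℕ}
    (c : complexBetti B.X (2 * p)) :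
    c ∈ algebraicClasses B.X p ↔ complexBetti.map φ (2 * p) c ∈ algebraicClasses Y p :=
  ⟨map_mem_algebraicClasses_of_abelianVariety hY B φ,
    mem_algebraicClasses_of_map_mem_of_surjective hY
      (Motives.AbelianVariety.isSmoothProjective_holds : IsSmoothProjective B.dim B.X) φ⟩

end AbelianVariety

/-! ### §2 The Weil plane is algebraic as soon as its pull-back along a surjective equidimensional map is -/

section WeilPlane

variable {B : Motives.AbelianVariety ℂ} {ψ₀ : B ⟶ B} {Y : Motives.SchemeOver ℂ}

/-- **The Weil plane from a surjective equidimensional cover, `dim`-free form.** For ANY complex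
abelian variety `B` with an endomorphism `ψ₀`, ANY smooth projective `Y` of dimension `dim B` and ANY
surjective `φ : Y ⟶ B`: if `φ^* c` is algebraic on `Y` for every class `c` of the plane
`Eig(T₈, (2 + i√3)⁸) ⊔ Eig(T₈, (2 - i√3)⁸)`, `T₈ = (2·𝟙 + ψ₀)^*|H⁸`, then the plane consists of
algebraic classes of `B` (Schoen: `U` algebraic ⇒ `U'` algebraic, for `Y = C⁸`, `φ = P ∘ Ξ`).
[cite: Schoen1988HodgeWeil, §3 Cor. 3.1 (proof, pp. 24–25) with Thm. 2.0] [cite: VoisinHodgeI2002, §7.3.2 Remark 7.29] -/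
theorem eigenspace_sup_eigenspace_le_algebraicClasses_of_surjective_of_forall_map_mem
    (hY : IsSmoothProjective B.dim Y) (φ : Y ⟶ B.X) [AlgebraicGeometry.Surjective φ.left]
    (h : ∀ c ∈ Module.End.eigenspace (complexBetti.map ((2 : ℤ) • 𝟙 B + ψ₀).hom.hom.hom 8).hom
          ((2 + Complex.I * (Real.sqrt (3 : ℝ) : ℂ)) ^ 8) ⊔
        Module.End.eigenspace (complexBetti.map ((2 : ℤ) • 𝟙 B + ψ₀).hom.hom.hom 8).hom
          ((2 - Complex.I * (Real.sqrt (3 : ℝ) : ℂ)) ^ 8),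
      complexBetti.map φ 8 c ∈ algebraicClasses Y 4) :
    Module.End.eigenspace (complexBetti.map ((2 : ℤ) • 𝟙 B + ψ₀).hom.hom.hom 8).hom
          ((2 + Complex.I * (Real.sqrt (3 : ℝ) : ℂ)) ^ 8) ⊔
        Module.End.eigenspace (complexBetti.map ((2 : ℤ) • 𝟙 B + ψ₀).hom.hom.hom 8).hom
          ((2 - Complex.I * (Real.sqrt (3 : ℝ) : ℂ)) ^ 8) ≤
      algebraicClasses B.X 4 :=
  Motives.AbelianVariety.le_algebraicClasses_of_surjective_of_forall_map_mem B hY φ (p := 4) h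

/-- **The Weil plane from ONE non-zero class with algebraic pull-back.** For `B` of dimension `8` with
`ψ₀ ≫ ψ₀ = -3`, a smooth projective `Y` of dimension `8` and a surjective `φ : Y ⟶ B`: if ONE non-zero
class `c` of the Weil plane `E₊ ⊔ E₋` has `φ^* c` algebraic on `Y`, then every class of the plane is
algebraic — `c` itself is algebraic by the degree trick (`mem_algebraicClasses_of_map_mem_of_surjective`),
and one non-zero algebraic Weil class suffices (`eigenspace_sup_eigenspace_le_algebraicClasses_of_exists`).
This is Schoen's Cor. 3.1 from his cycle `z_χ` on `C⁸` (proof of Thm. 2.0, case `r = 0`), the transfer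
`C⁸ → B` done by the degree trick. [cite: Schoen1988HodgeWeil, §2 p. 13 (proof of Thm. 2.0, case r = 0) and §3 Cor. 3.1 (proof, pp. 24–25)]
[cite: VoisinHodgeI2002, §7.3.2 Remark 7.29] -/
theorem eigenspace_sup_eigenspace_le_algebraicClasses_of_surjective_of_exists (hdim : B.dim = 8)
    (hψ : ψ₀ ≫ ψ₀ = -(3 • 𝟙 B)) (hY : IsSmoothProjective 8 Y) (φ : Y ⟶ B.X)
    [AlgebraicGeometry.Surjective φ.left]
    (h : ∃ c ∈ Module.End.eigenspace (complexBetti.map ((2 : ℤ) • 𝟙 B + ψ₀).hom.hom.hom 8).hom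
          ((2 + Complex.I * (Real.sqrt (3 : ℝ) : ℂ)) ^ 8) ⊔
        Module.End.eigenspace (complexBetti.map ((2 : ℤ) • 𝟙 B + ψ₀).hom.hom.hom 8).hom
          ((2 - Complex.I * (Real.sqrt (3 : ℝ) : ℂ)) ^ 8),
      complexBetti.map φ 8 c ∈ algebraicClasses Y 4 ∧ c ≠ 0) :
    Module.End.eigenspace (complexBetti.map ((2 : ℤ) • 𝟙 B + ψ₀).hom.hom.hom 8).hom
          ((2 + Complex.I * (Real.sqrt (3 : ℝ) : ℂ)) ^ 8) ⊔
        Module.End.eigenspace (complexBetti.map ((2 : ℤ) • 𝟙 B + ψ₀).hom.hom.hom 8).hom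
          ((2 - Complex.I * (Real.sqrt (3 : ℝ) : ℂ)) ^ 8) ≤
      algebraicClasses B.X 4 := by
  have hB : IsSmoothProjective 8 B.X := by
    rw [← hdim]
    exact Motives.AbelianVariety.isSmoothProjective_holds
  obtain ⟨c, hc, hφc, hc0⟩ := h
  exact eigenspace_sup_eigenspace_le_algebraicClasses_of_exists hdim hψ
    ⟨c, hc, mem_algebraicClasses_of_map_mem_of_surjective hY hB φ (p := 4) hφc, hc0⟩

/-- **The `weilClassesOf` form** (degree-`3` fact): for `B` of dimension `8` with `ψ₀ ≫ ψ₀ = -3`, a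
smooth projective `Y` of dimension `8` and a surjective `φ : Y ⟶ B`, ONE non-zero class of
`weilClassesOf B ψ₀ 4 3 = E₊ ⊔ E₋` with algebraic pull-back makes all of it algebraic
(`weilClassesOf_le_algebraicClasses_of_exists_mem` and the degree trick).
[cite: Schoen1988HodgeWeil, §3 Cor. 3.1 (proof, pp. 24–25) with Thm. 2.0] [cite: VoisinHodgeI2002, §7.3.2 Remark 7.29] -/
theorem weilClassesOf_le_algebraicClasses_of_surjective_of_exists (hdim : B.dim = 8)
    (hψ : ψ₀ ≫ ψ₀ = -(3 • 𝟙 B)) (hY : IsSmoothProjective 8 Y) (φ : Y ⟶ B.X)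
    [AlgebraicGeometry.Surjective φ.left]
    (h : ∃ c ∈ weilClassesOf B ψ₀ 4 3, complexBetti.map φ (2 * 4) c ∈ algebraicClasses Y 4 ∧ c ≠ 0) :
    weilClassesOf B ψ₀ 4 3 ≤ algebraicClasses B.X 4 := by
  have hB : IsSmoothProjective 8 B.X := by
    rw [← hdim]
    exact Motives.AbelianVariety.isSmoothProjective_holds
  obtain ⟨c, hc, hφc, hc0⟩ := h
  exact weilClassesOf_le_algebraicClasses_of_exists_mem hdim hψ
    ⟨c, hc, mem_algebraicClasses_of_map_mem_of_surjective hY hB φ (p := 4) hφc, hc0⟩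

end WeilPlane

/-! ### §3 Assemblies for the degree-`6` fact -/

section AssemblySix

/-- **Schoen's degree-`6` fact from Thm. 2.0 in transferred form — WITHOUT the Jacobian-dimension
fact.** The named fact `Schoen1988_cyclicPrym_weilClasses_algebraic_degreeSix` follows as soon as, for
every Schoen datum `(C, 𝒥, α, s = α_*, B = (ker Φ₆(s))⁰, s_B, ψ₀)`, there are a smooth projective `Y`
of dimension `dim B` and a SURJECTIVE `φ : Y ⟶ B` along which every class of the Weil plane pulls back
to an algebraic class of `Y` (Schoen: `Y = C⁸`, `φ = P ∘ Ξ`, `φ^* U' ⊗ ℂ = U ⊗ ℂ` generated by the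
classes of the cycles `z_χ` of Thm. 2.0). Neither `dim B = 8` nor `Motives.two_mul_dim_eq_finrank_bettiCohomology`
is used. [cite: Schoen1988HodgeWeil, Thm. 2.0 (p. 11) and §3 Cor. 3.1 (p. 24, proof pp. 24–25)]
[cite: PatelZhang2025PrymHodge, Thm 4.4, Lemma 4.5 and Thm 5.3] -/
theorem Schoen1988_cyclicPrym_weilClasses_algebraic_degreeSix_of_forall_exists_surjective
    (hW : ∀ (C : Motives.SchemeOver ℂ) (𝒥 : Jacobian C) (α : C ⟶ C),
      IsSmoothProjective 1 C → 𝒥.J.dim = 25 →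
      α ≫ α ≫ α ≫ α ≫ α ≫ α = 𝟙 C →
      (∀ P : ComplexPoints C, P ≫ (α ≫ α) ≠ P ∧ P ≫ (α ≫ α ≫ α) ≠ P) →
    ∀ (s : 𝒥.J ⟶ 𝒥.J), s = 𝒥.pushforward 𝒥 α →
    ∀ (sB ψ₀ : AbelianVariety.kerComponent (𝟙 𝒥.J - s + s ≫ s) ⟶
        AbelianVariety.kerComponent (𝟙 𝒥.J - s + s ≫ s)),
      sB ≫ AbelianVariety.kerComponentι (𝟙 𝒥.J - s + s ≫ s) =
        AbelianVariety.kerComponentι (𝟙 𝒥.J - s + s ≫ s) ≫ s →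
      ψ₀ = 𝟙 _ + 2 • (sB ≫ sB) →
      ∃ (Y : Motives.SchemeOver ℂ)
        (_ : IsSmoothProjective (AbelianVariety.kerComponent (𝟙 𝒥.J - s + s ≫ s)).dim Y)
        (φ : Y ⟶ (AbelianVariety.kerComponent (𝟙 𝒥.J - s + s ≫ s)).X)
        (_ : AlgebraicGeometry.Surjective φ.left),
        ∀ c ∈ Module.End.eigenspace
              (complexBetti.map ((2 : ℤ) • 𝟙 (AbelianVariety.kerComponent (𝟙 𝒥.J - s + s ≫ s)) +
                ψ₀).hom.hom.hom 8).hom ((2 + Complex.I * (Real.sqrt (3 : ℝ) : ℂ)) ^ 8) ⊔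
            Module.End.eigenspace
              (complexBetti.map ((2 : ℤ) • 𝟙 (AbelianVariety.kerComponent (𝟙 𝒥.J - s + s ≫ s)) +
                ψ₀).hom.hom.hom 8).hom ((2 - Complex.I * (Real.sqrt (3 : ℝ) : ℂ)) ^ 8),
          complexBetti.map φ 8 c ∈ algebraicClasses Y 4) :
    Schoen1988_cyclicPrym_weilClasses_algebraic_degreeSix := by
  intro C 𝒥 α hC h25 hα hfree s hs sB ψ₀ hsB hψ₀ c hc
  obtain ⟨Y, hY, φ, hφ, h⟩ := hW C 𝒥 α hC h25 hα hfree s hs sB ψ₀ hsB hψ₀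
  exact eigenspace_sup_eigenspace_le_algebraicClasses_of_surjective_of_forall_map_mem hY φ h hc

/-- **Schoen's degree-`6` fact from its two kernels, the geometric one in transferred form**: (i′)
`b₁(C(ℂ)) ≤ 2 dim J(C)` on Schoen data (the open half of Milne Prop. 2.1; it gives `dim B = 8`,
`dim_kerComponent_cyclotomic₆_pushforward_eq_eight_of_finrank_le`) and (iii″) a smooth projective `Y`
of dimension `8` with a surjective `φ : Y ⟶ B` and ONE non-zero class of the Weil plane whose
pull-back along `φ` is algebraic (Schoen's `z_χ` on `C⁸` under `P ∘ Ξ`).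
[cite: Schoen1988HodgeWeil, §2 p. 13 (proof of Thm. 2.0, case r = 0) and §3 Cor. 3.1 (p. 24)]
[cite: Milne1986JacobianVarieties, §2 Prop. 2.1] [cite: PatelZhang2025PrymHodge, Lemma 5.1 and Thm 5.3] -/
theorem Schoen1988_cyclicPrym_weilClasses_algebraic_degreeSix_of_finrank_le_of_exists_surjective
    (hb : ∀ (C : Motives.SchemeOver ℂ) (𝒥 : Jacobian C) (α : C ⟶ C),
      IsSmoothProjective 1 C → 𝒥.J.dim = 25 →
      α ≫ α ≫ α ≫ α ≫ α ≫ α = 𝟙 C →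
      (∀ P : ComplexPoints C, P ≫ (α ≫ α) ≠ P ∧ P ≫ (α ≫ α ≫ α) ≠ P) →
      Module.finrank ℚ (bettiCohomology C 1) ≤ 2 * 𝒥.J.dim)
    (hZ : ∀ (C : Motives.SchemeOver ℂ) (𝒥 : Jacobian C) (α : C ⟶ C),
      IsSmoothProjective 1 C → 𝒥.J.dim = 25 →
      α ≫ α ≫ α ≫ α ≫ α ≫ α = 𝟙 C →
      (∀ P : ComplexPoints C, P ≫ (α ≫ α) ≠ P ∧ P ≫ (α ≫ α ≫ α) ≠ P) →
    ∀ (s : 𝒥.J ⟶ 𝒥.J), s = 𝒥.pushforward 𝒥 α →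
    ∀ (sB ψ₀ : AbelianVariety.kerComponent (𝟙 𝒥.J - s + s ≫ s) ⟶
        AbelianVariety.kerComponent (𝟙 𝒥.J - s + s ≫ s)),
      sB ≫ AbelianVariety.kerComponentι (𝟙 𝒥.J - s + s ≫ s) =
        AbelianVariety.kerComponentι (𝟙 𝒥.J - s + s ≫ s) ≫ s →
      ψ₀ = 𝟙 _ + 2 • (sB ≫ sB) →
      ∃ (Y : Motives.SchemeOver ℂ) (_ : IsSmoothProjective 8 Y)
        (φ : Y ⟶ (AbelianVariety.kerComponent (𝟙 𝒥.J - s + s ≫ s)).X)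
        (_ : AlgebraicGeometry.Surjective φ.left),
        ∃ c ∈ Module.End.eigenspace
              (complexBetti.map ((2 : ℤ) • 𝟙 (AbelianVariety.kerComponent (𝟙 𝒥.J - s + s ≫ s)) +
                ψ₀).hom.hom.hom 8).hom ((2 + Complex.I * (Real.sqrt (3 : ℝ) : ℂ)) ^ 8) ⊔
            Module.End.eigenspace
              (complexBetti.map ((2 : ℤ) • 𝟙 (AbelianVariety.kerComponent (𝟙 𝒥.J - s + s ≫ s)) +
                ψ₀).hom.hom.hom 8).hom ((2 - Complex.I * (Real.sqrt (3 : ℝ) : ℂ)) ^ 8),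
          complexBetti.map φ 8 c ∈ algebraicClasses Y 4 ∧ c ≠ 0) :
    Schoen1988_cyclicPrym_weilClasses_algebraic_degreeSix := by
  intro C 𝒥 α hC h25 hα hfree s hs sB ψ₀ hsB hψ₀ c hc
  obtain ⟨Y, hY, φ, hφ, h⟩ := hZ C 𝒥 α hC h25 hα hfree s hs sB ψ₀ hsB hψ₀
  exact eigenspace_sup_eigenspace_le_algebraicClasses_of_surjective_of_exists
    (dim_kerComponent_cyclotomic₆_pushforward_eq_eight_of_finrank_le 𝒥 α hC h25 (hb C 𝒥 α hC h25 hα hfree)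
      hα hfree hs)
    (kerComponent_weilOperator_comp_self' hsB hψ₀) hY φ h hc

/-- **The degree-`6` fact from `two_mul_dim_eq_finrank_bettiCohomology` and (iii″)** (the named
Jacobian fact `2 dim J = b₁(C(ℂ))`, Milne Prop. 2.1, supplies (i′)).
[cite: Milne1986JacobianVarieties, §2 Prop. 2.1 and Thm. 2.5] [cite: Schoen1988HodgeWeil, §3 Cor. 3.1 (p. 24) with Thm. 2.0] -/
theorem Schoen1988_cyclicPrym_weilClasses_algebraic_degreeSix_of_two_mul_dim_eq_of_exists_surjective
    (hT : Motives.two_mul_dim_eq_finrank_bettiCohomology)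
    (hZ : ∀ (C : Motives.SchemeOver ℂ) (𝒥 : Jacobian C) (α : C ⟶ C),
      IsSmoothProjective 1 C → 𝒥.J.dim = 25 →
      α ≫ α ≫ α ≫ α ≫ α ≫ α = 𝟙 C →
      (∀ P : ComplexPoints C, P ≫ (α ≫ α) ≠ P ∧ P ≫ (α ≫ α ≫ α) ≠ P) →
    ∀ (s : 𝒥.J ⟶ 𝒥.J), s = 𝒥.pushforward 𝒥 α →
    ∀ (sB ψ₀ : AbelianVariety.kerComponent (𝟙 𝒥.J - s + s ≫ s) ⟶
        AbelianVariety.kerComponent (𝟙 𝒥.J - s + s ≫ s)),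
      sB ≫ AbelianVariety.kerComponentι (𝟙 𝒥.J - s + s ≫ s) =
        AbelianVariety.kerComponentι (𝟙 𝒥.J - s + s ≫ s) ≫ s →
      ψ₀ = 𝟙 _ + 2 • (sB ≫ sB) →
      ∃ (Y : Motives.SchemeOver ℂ) (_ : IsSmoothProjective 8 Y)
        (φ : Y ⟶ (AbelianVariety.kerComponent (𝟙 𝒥.J - s + s ≫ s)).X)
        (_ : AlgebraicGeometry.Surjective φ.left),
        ∃ c ∈ Module.End.eigenspace
              (complexBetti.map ((2 : ℤ) • 𝟙 (AbelianVariety.kerComponent (𝟙 𝒥.J - s + s ≫ s)) +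
                ψ₀).hom.hom.hom 8).hom ((2 + Complex.I * (Real.sqrt (3 : ℝ) : ℂ)) ^ 8) ⊔
            Module.End.eigenspace
              (complexBetti.map ((2 : ℤ) • 𝟙 (AbelianVariety.kerComponent (𝟙 𝒥.J - s + s ≫ s)) +
                ψ₀).hom.hom.hom 8).hom ((2 - Complex.I * (Real.sqrt (3 : ℝ) : ℂ)) ^ 8),
          complexBetti.map φ 8 c ∈ algebraicClasses Y 4 ∧ c ≠ 0) :
    Schoen1988_cyclicPrym_weilClasses_algebraic_degreeSix :=
  Schoen1988_cyclicPrym_weilClasses_algebraic_degreeSix_of_finrank_le_of_exists_surjective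
    (fun C 𝒥 _ hC _ _ _ => (hT C hC 𝒥).ge) hZ

/-- **The degree-`6` fact from `isIso_bettiCohomology_map_abelJacobi` and (iii″).**
[cite: Lange2023AbelianVarietiesC, §4.1.1 and Lemma 4.4.1] [cite: Schoen1988HodgeWeil, §3 Cor. 3.1 (p. 24) with Thm. 2.0] -/
theorem Schoen1988_cyclicPrym_weilClasses_algebraic_degreeSix_of_isIso_of_exists_surjective
    (hI : Motives.isIso_bettiCohomology_map_abelJacobi)
    (hZ : ∀ (C : Motives.SchemeOver ℂ) (𝒥 : Jacobian C) (α : C ⟶ C),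
      IsSmoothProjective 1 C → 𝒥.J.dim = 25 →
      α ≫ α ≫ α ≫ α ≫ α ≫ α = 𝟙 C →
      (∀ P : ComplexPoints C, P ≫ (α ≫ α) ≠ P ∧ P ≫ (α ≫ α ≫ α) ≠ P) →
    ∀ (s : 𝒥.J ⟶ 𝒥.J), s = 𝒥.pushforward 𝒥 α →
    ∀ (sB ψ₀ : AbelianVariety.kerComponent (𝟙 𝒥.J - s + s ≫ s) ⟶
        AbelianVariety.kerComponent (𝟙 𝒥.J - s + s ≫ s)),
      sB ≫ AbelianVariety.kerComponentι (𝟙 𝒥.J - s + s ≫ s) =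
        AbelianVariety.kerComponentι (𝟙 𝒥.J - s + s ≫ s) ≫ s →
      ψ₀ = 𝟙 _ + 2 • (sB ≫ sB) →
      ∃ (Y : Motives.SchemeOver ℂ) (_ : IsSmoothProjective 8 Y)
        (φ : Y ⟶ (AbelianVariety.kerComponent (𝟙 𝒥.J - s + s ≫ s)).X)
        (_ : AlgebraicGeometry.Surjective φ.left),
        ∃ c ∈ Module.End.eigenspace
              (complexBetti.map ((2 : ℤ) • 𝟙 (AbelianVariety.kerComponent (𝟙 𝒥.J - s + s ≫ s)) +
                ψ₀).hom.hom.hom 8).hom ((2 + Complex.I * (Real.sqrt (3 : ℝ) : ℂ)) ^ 8) ⊔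
            Module.End.eigenspace
              (complexBetti.map ((2 : ℤ) • 𝟙 (AbelianVariety.kerComponent (𝟙 𝒥.J - s + s ≫ s)) +
                ψ₀).hom.hom.hom 8).hom ((2 - Complex.I * (Real.sqrt (3 : ℝ) : ℂ)) ^ 8),
          complexBetti.map φ 8 c ∈ algebraicClasses Y 4 ∧ c ≠ 0) :
    Schoen1988_cyclicPrym_weilClasses_algebraic_degreeSix :=
  Schoen1988_cyclicPrym_weilClasses_algebraic_degreeSix_of_two_mul_dim_eq_of_exists_surjective
    (Motives.two_mul_dim_eq_finrank_bettiCohomology_of_isIso hI) hZ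

end AssemblySix

/-! ### §4 Assemblies for the degree-`3` fact -/

section AssemblyThree

/-- **The degree-`3` fact from Thm. 2.0 in transferred form — WITHOUT the Jacobian-dimension fact**:
for every degree-`3` Schoen datum `(C, 𝒥, α, s, P = (ker (𝟙 + s + s²))⁰, s_P, ψ₀)`, a smooth
projective `Y` of dimension `dim P` and a surjective `φ : Y ⟶ P` along which every class of
`weilClassesOf P ψ₀ 4 3` pulls back to an algebraic class.
[cite: Schoen1988HodgeWeil, Thm. 2.0 (p. 11) and §3 Cor. 3.1 (p. 24, proof pp. 24–25)]
[cite: PatelZhang2025PrymHodge, Thm 4.4 and Thm 1.2] -/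
theorem Schoen1988_cyclicPrym_weilClasses_algebraic_degreeThree_of_forall_exists_surjective
    (hW : ∀ (C : Motives.SchemeOver ℂ) (𝒥 : Jacobian C) (α : C ⟶ C),
      IsSmoothProjective 1 C → 𝒥.J.dim = 13 →
      α ≫ α ≫ α = 𝟙 C →
      (∀ P : ComplexPoints C, P ≫ α ≠ P) →
    ∀ (s : 𝒥.J ⟶ 𝒥.J), s = 𝒥.pushforward 𝒥 α →
    ∀ (sP ψ₀ : AbelianVariety.kerComponent (𝟙 𝒥.J + s + s ≫ s) ⟶
        AbelianVariety.kerComponent (𝟙 𝒥.J + s + s ≫ s)),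
      sP ≫ AbelianVariety.kerComponentι (𝟙 𝒥.J + s + s ≫ s) =
        AbelianVariety.kerComponentι (𝟙 𝒥.J + s + s ≫ s) ≫ s →
      ψ₀ = 𝟙 _ + 2 • sP →
      ∃ (Y : Motives.SchemeOver ℂ)
        (_ : IsSmoothProjective (AbelianVariety.kerComponent (𝟙 𝒥.J + s + s ≫ s)).dim Y)
        (φ : Y ⟶ (AbelianVariety.kerComponent (𝟙 𝒥.J + s + s ≫ s)).X)
        (_ : AlgebraicGeometry.Surjective φ.left),
        ∀ c ∈ weilClassesOf (AbelianVariety.kerComponent (𝟙 𝒥.J + s + s ≫ s)) ψ₀ 4 3,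
          complexBetti.map φ (2 * 4) c ∈ algebraicClasses Y 4) :
    Schoen1988_cyclicPrym_weilClasses_algebraic_degreeThree := by
  intro C 𝒥 α hC h13 hα hfree s hs sP ψ₀ hsP hψ₀ c hc
  obtain ⟨Y, hY, φ, hφ, h⟩ := hW C 𝒥 α hC h13 hα hfree s hs sP ψ₀ hsP hψ₀
  exact Motives.AbelianVariety.le_algebraicClasses_of_surjective_of_forall_map_mem _ hY φ (p := 4) h hc

/-- **The degree-`3` fact from its two kernels, the geometric one in transferred form**: (i′)
`b₁(C(ℂ)) ≤ 2 dim J(C)` on degree-`3` Schoen data (gives `dim P = 8`,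
`dim_kerComponent_cyclotomic₃_pushforward_eq_eight_of_finrank_le`) and (iii″) a smooth projective
`Y` of dimension `8`, a surjective `φ : Y ⟶ P` and ONE non-zero class of `weilClassesOf P ψ₀ 4 3`
with algebraic pull-back. [cite: Schoen1988HodgeWeil, §3 Cor. 3.1 (p. 24) with Thm. 2.0]
[cite: Milne1986JacobianVarieties, §2 Prop. 2.1] [cite: PatelZhang2025PrymHodge, Lemma 5.1 and Thm 1.2] -/
theorem Schoen1988_cyclicPrym_weilClasses_algebraic_degreeThree_of_finrank_le_of_exists_surjective
    (hb : ∀ (C : Motives.SchemeOver ℂ) (𝒥 : Jacobian C) (α : C ⟶ C),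
      IsSmoothProjective 1 C → 𝒥.J.dim = 13 →
      α ≫ α ≫ α = 𝟙 C →
      (∀ P : ComplexPoints C, P ≫ α ≠ P) →
      Module.finrank ℚ (bettiCohomology C 1) ≤ 2 * 𝒥.J.dim)
    (hZ : ∀ (C : Motives.SchemeOver ℂ) (𝒥 : Jacobian C) (α : C ⟶ C),
      IsSmoothProjective 1 C → 𝒥.J.dim = 13 →
      α ≫ α ≫ α = 𝟙 C →
      (∀ P : ComplexPoints C, P ≫ α ≠ P) →
    ∀ (s : 𝒥.J ⟶ 𝒥.J), s = 𝒥.pushforward 𝒥 α →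
    ∀ (sP ψ₀ : AbelianVariety.kerComponent (𝟙 𝒥.J + s + s ≫ s) ⟶
        AbelianVariety.kerComponent (𝟙 𝒥.J + s + s ≫ s)),
      sP ≫ AbelianVariety.kerComponentι (𝟙 𝒥.J + s + s ≫ s) =
        AbelianVariety.kerComponentι (𝟙 𝒥.J + s + s ≫ s) ≫ s →
      ψ₀ = 𝟙 _ + 2 • sP →
      ∃ (Y : Motives.SchemeOver ℂ) (_ : IsSmoothProjective 8 Y)
        (φ : Y ⟶ (AbelianVariety.kerComponent (𝟙 𝒥.J + s + s ≫ s)).X)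
        (_ : AlgebraicGeometry.Surjective φ.left),
        ∃ c ∈ weilClassesOf (AbelianVariety.kerComponent (𝟙 𝒥.J + s + s ≫ s)) ψ₀ 4 3,
          complexBetti.map φ (2 * 4) c ∈ algebraicClasses Y 4 ∧ c ≠ 0) :
    Schoen1988_cyclicPrym_weilClasses_algebraic_degreeThree := by
  intro C 𝒥 α hC h13 hα hfree s hs sP ψ₀ hsP hψ₀ c hc
  obtain ⟨Y, hY, φ, hφ, h⟩ := hZ C 𝒥 α hC h13 hα hfree s hs sP ψ₀ hsP hψ₀
  exact weilClassesOf_le_algebraicClasses_of_surjective_of_exists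
    (dim_kerComponent_cyclotomic₃_pushforward_eq_eight_of_finrank_le 𝒥 α hC h13 (hb C 𝒥 α hC h13 hα hfree)
      hα hfree hs)
    (kerComponent_weilOperator_comp_self_of_cyclotomic₃' hsP hψ₀) hY φ h hc

/-- **The degree-`3` fact from `two_mul_dim_eq_finrank_bettiCohomology` and (iii″).**
[cite: Milne1986JacobianVarieties, §2 Prop. 2.1 and Thm. 2.5] [cite: Schoen1988HodgeWeil, §3 Cor. 3.1 (p. 24) with Thm. 2.0] -/
theorem Schoen1988_cyclicPrym_weilClasses_algebraic_degreeThree_of_two_mul_dim_eq_of_exists_surjective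
    (hT : Motives.two_mul_dim_eq_finrank_bettiCohomology)
    (hZ : ∀ (C : Motives.SchemeOver ℂ) (𝒥 : Jacobian C) (α : C ⟶ C),
      IsSmoothProjective 1 C → 𝒥.J.dim = 13 →
      α ≫ α ≫ α = 𝟙 C →
      (∀ P : ComplexPoints C, P ≫ α ≠ P) →
    ∀ (s : 𝒥.J ⟶ 𝒥.J), s = 𝒥.pushforward 𝒥 α →
    ∀ (sP ψ₀ : AbelianVariety.kerComponent (𝟙 𝒥.J + s + s ≫ s) ⟶
        AbelianVariety.kerComponent (𝟙 𝒥.J + s + s ≫ s)),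
      sP ≫ AbelianVariety.kerComponentι (𝟙 𝒥.J + s + s ≫ s) =
        AbelianVariety.kerComponentι (𝟙 𝒥.J + s + s ≫ s) ≫ s →
      ψ₀ = 𝟙 _ + 2 • sP →
      ∃ (Y : Motives.SchemeOver ℂ) (_ : IsSmoothProjective 8 Y)
        (φ : Y ⟶ (AbelianVariety.kerComponent (𝟙 𝒥.J + s + s ≫ s)).X)
        (_ : AlgebraicGeometry.Surjective φ.left),
        ∃ c ∈ weilClassesOf (AbelianVariety.kerComponent (𝟙 𝒥.J + s + s ≫ s)) ψ₀ 4 3,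
          complexBetti.map φ (2 * 4) c ∈ algebraicClasses Y 4 ∧ c ≠ 0) :
    Schoen1988_cyclicPrym_weilClasses_algebraic_degreeThree :=
  Schoen1988_cyclicPrym_weilClasses_algebraic_degreeThree_of_finrank_le_of_exists_surjective
    (fun C 𝒥 _ hC _ _ _ => (hT C hC 𝒥).ge) hZ

end AssemblyThree

end Literature.AlgebraicGeometry.HodgeTheory

end
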